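import Literature.IUT.LogThetaLattice.StripFrameWitness
import Literature.IUT.LogThetaLattice.BiCoresRealified
import HarnessLib

/-!
# [IUTchIII] Thm 1.5 (v) «induce AN isomorphism» — the universal-closure certificate for the FACT-LIST predicate
# `BiCoricData.Thm15vSingleIso` (F-2067), twin of `not_forall_realifiedRigidAt` (F-2066)

S. Mochizuki, *Inter-universal Teichmüller theory III*, kurims manuscript (May 2020), §1, Thm. 1.5 (v) pp. 50–51 («the
poly-isomorphisms of `D^⊢`-prime-strips … induce [cf. [IUTchII], Corollaries 4.5, (ii); 4.10, (v)] an isomorphism of collections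
of data …»), with *II* (Dec 2020) Cor. 4.10 (v) p. 160 [claim: Mochizuki2012, status: disputed] (D-0012 claim key; nothing of the
series is asserted here).  abc-iut cell, L-F family register LF5/6 row **LF6-05** (plan/L6/LF-IUT.tsv, abc-iut-L6-lead ROWS #3),
seat abc-iut-w6-d032 gen 6.  PROOF-ONLY (no `def`, no `instance`; abc-iut-L6-t3's `StripFrameWitness.lean` and
`BiCoresRealified.lean` are consumed BY NAME, never edited or restated).

The frozen FACT-LIST carries the printed sentence of Thm. 1.5 (v) twice: **F-2066** `BiCoricData.RealifiedRigidAt` (the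
[IUTchII] Cor. 4.10 (v) rigidity at a pair of `D^⊢`-prime-strips) and **F-2067** `BiCoricData.Thm15vSingleIso` (the induced
poly-isomorphism of `D^⊩`-data has exactly one constituent).  For F-2066 the tree already holds the closure certificate BY NAME
(`not_forall_realifiedRigidAt`, `LayerSixInputSchemaCertificates.lean`, abc-iut-w4-d007): label «universal-closure REFUTED /
schema; instance forms are the content».  For F-2067 the ingredient was in the tree (abc-iut-L6-t3's
`Witness.two_biCoricRealifiedPolyIso_not_subsingleton`: at the witness datum `Witness.twoBiCoric` — `D^⊩(−) := 𝟭` over the frame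
whose `D^⊢`-prime-strips form the one-object groupoid on `ℤˣ = {±1}` — the induced poly-isomorphism has the two constituents `1`,
`−1`) but no statement about the FACT-LIST predicate by name, so plan/LF-KERNEL-STATUS.tsv (abc-iut-F-lit, 03:09Z) lists F-2067 as
«LABEL-OPEN … no closure refuter».  This file supplies the three one-line certificates:

* `Witness.not_thm15vSingleIso_twoBiCoric` — F-2067 FAILS at `Witness.twoBiCoric`;
* `not_forall_thm15vSingleIso` — the universal closure of F-2067 (over all frames and bi-coric data) is FALSE (type
  definitionally `¬ ∀ S B, B.Thm15vSingleIso`);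
* `Witness.thm15vSingleIso_twoBiCoricRigid` — F-2067 HOLDS at the rigid variant `Witness.twoBiCoricRigid` (`D^⊩(−) :=` the
  constant functor), i.e. the predicate is independent of the other interface laws.

INSTANCE FORMS OF RECORD (what the cone actually consumes; all landed, cited here only by name): at the real frame's bi-coric data
assembled from the canonical companion kit `Bk.withRealifiedD line c hc` — realified slot := [IUTchII] Cor. 4.5 (ii)'s functor
`realifiedD` — `thm15vSingleIso_ofKits_withRealifiedD` / `realifiedRigidAt_ofKits_withRealifiedD` (abc-iut-w4-d005,
`BiCoresOfKitsWithRealifiedD.lean`, NO hypothesis), the companion-glue forms `thm15vSingleIso_glue_withRealifiedD` /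
`realifiedRigidAt_glue_withRealifiedD` / `exists_kummerCoherent_companion` (`LatticeGlueOfKitsWithRealifiedD.lean`), and for an
ARBITRARY bi-coric datum the conditional closers `BiCoricData.thm15vSingleIso_of_realifiedD` / `realifiedRigidAt_of_realifiedD`
(abc-iut-w4-d005, `BiCoresRealifiedDFunctor.lean`; binders: a faithful reading `U` of `B.RFrob` in `RlfData V` and
`η : B.realified ⋙ U ≅ Φ ⋙ realifiedD line c hc`).

HONEST FRAMING: a refuted universal closure is a statement about OUR typing (the interface `BiCoricData` admits the degenerate
inhabitant `twoBiCoric`), not about the printed proposition, which concerns [IUTchII] Cor. 4.5 (ii)'s functor — where the cited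
instance-form theorems apply.  Nothing here bears on [IUTchIII] Cor. 3.12 or takes a side; typed ≠ proved; nothing asserts abc
proved or refuted.
-/

namespace Literature.IUT.LogThetaLattice

open CategoryTheory

namespace Witness

/-- **IUTchIII:Thm1.5(v)** (kurims p.50) At abc-iut-L6-t3's witness bi-coric datum `Witness.twoBiCoric` (`D^⊩(−) := 𝟭` over the
frame whose `D^⊢`-prime-strip category is the one-object groupoid on `ℤˣ = {±1}`, `D`-Hodge theaters `Discrete PUnit`) the FACT-LIST
predicate `Thm15vSingleIso` FAILS: between the (unique) `D`-Θ^{±ell}NF-Hodge theaters the induced poly-isomorphism of `D^⊩`-data has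
the two distinct constituents `1` and `−1` (`two_biCoricRealifiedPolyIso_not_subsingleton`).
[claim: Mochizuki2012, status: disputed] (IUTchIII §1 Thm 1.5 (v), kurims p.50) -/
theorem not_thm15vSingleIso_twoBiCoric : ¬ twoBiCoric.Thm15vSingleIso :=
  fun h => two_biCoricRealifiedPolyIso_not_subsingleton ⟨PUnit.unit⟩ ⟨PUnit.unit⟩ (h ⟨PUnit.unit⟩ ⟨PUnit.unit⟩)

/-- **IUTchIII:Thm1.5(v)** (kurims p.50) At the RIGID variant `Witness.twoBiCoricRigid` (same frame, `D^⊩(−) :=` the constant functor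
to `Discrete PUnit`) the FACT-LIST predicate `Thm15vSingleIso` HOLDS (`twoRigid_biCoricRealifiedPolyIso_subsingleton`): together with
`not_thm15vSingleIso_twoBiCoric`, the predicate is independent of the other laws of the interface `BiCoricData`.
[claim: Mochizuki2012, status: disputed] (IUTchIII §1 Thm 1.5 (v), kurims p.50) -/
theorem thm15vSingleIso_twoBiCoricRigid : twoBiCoricRigid.Thm15vSingleIso :=
  fun H H' => twoRigid_biCoricRealifiedPolyIso_subsingleton H H'

end Witness

/-- **F-2067 is a schema**: the universal closure of `BiCoricData.Thm15vSingleIso` (over all frames and all bi-coric data) is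
FALSE — refuted at `Witness.twoBiCoric`; the instance forms the cone uses are `thm15vSingleIso_ofKits_withRealifiedD` (real frame,
canonical companion kit, no hypothesis) and, for an arbitrary bi-coric datum, `BiCoricData.thm15vSingleIso_of_realifiedD` («AN
isomorphism» HOLDS whenever `D^⊩(−)` is read, faithfully and up to natural isomorphism, as [IUTchII] Cor. 4.5 (ii)'s functor).  Twin of
`not_forall_realifiedRigidAt` (F-2066). [claim: Mochizuki2012, status: disputed] (IUTchIII §1 Thm 1.5 (v), kurims p.50) -/
theorem not_forall_thm15vSingleIso :
    ¬ ∀ (S : StripFrame.{0}) (B : BiCoricData S), B.Thm15vSingleIso :=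
  fun h => Witness.not_thm15vSingleIso_twoBiCoric (h Witness.twoFrame Witness.twoBiCoric)

/-- **IUTchIII:Thm1.5(v)** (kurims p.50) the same certificate in the rigidity currency of F-2066: the universal closure of «the
[IUTchII] Cor. 4.10 (v) rigidity holds at every pair `(^{n,m}D^⊢_△, ^{n′,m′}D^⊢_△)`» — the right-hand side of abc-iut-L6-t3's
`thm15vSingleIso_iff_rigid` — is FALSE. [claim: Mochizuki2012, status: disputed] (IUTchIII §1 Thm 1.5 (v), kurims p.50) -/
theorem not_forall_realifiedRigidAt_dvDeltaOf :
    ¬ ∀ (S : StripFrame.{0}) (B : BiCoricData S) (H H' : S.DHT), B.RealifiedRigidAt (B.dvDeltaOf H) (B.dvDeltaOf H') :=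
  fun h => Witness.not_thm15vSingleIso_twoBiCoric
    ((BiCoricData.thm15vSingleIso_iff_rigid Witness.twoBiCoric).mpr (h Witness.twoFrame Witness.twoBiCoric))

end Literature.IUT.LogThetaLattice
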